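import Mathlib
import HarnessLib
import Summits.ResolutionOfSingularities.ResolutionOfSingularities.Theorems.WildQuotientsWildQuotientResolutionS1aMoveAtlas
import Summits.ResolutionOfSingularities.ResolutionOfSingularities.Theorems.WildQuotientsWildQuotientResolutionS1aAuxResidual

/-!
# S1a — K-FREE FRAME, (F-T8) residual form: atlas assembly from GIVEN producer node data, and the RESIDUAL IDEAL certificate «off `V(𝔞)` the producer chart is principal»

[OURS · L1 W4.5c · lead-1 g12; plan-1 RULING R-F15b (3) «UPPER BOUND AT A RESIDUAL NODE: F′ ⊆ ⋃_C V(H_C) where H_C ⊆ J̃_C := aug_C : β̃′_C», (6);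
A-KF v1 §2.1–2.2; `…S1aAuxResidual` (✓p637654: under (H1) `aug σ_R ≤ (g)`, on every σ-fixed chart `aug σ′ = (g)·𝔞R_b`, `𝔞 = (aug σ_R : g)`)] — NOT
statements of the manuscript; counted 0; AI-level work, weaker than expert review. Crux stmt-ResolutionOfSingularities-17941 `CyclicQuotientFourfolds`, line
`s1a-logminvertex` v12 (`stub_reachLowerInF`).

* ★ `exists_moveAtlas_of_nodeData` — CHOICE-FREE assembly: a move `π′ : M′ → M` along a `G`-stable `𝒦_d` with `supp ⊆ O`, ANY family of stable affine
  opens `O′_j` of `M′` covering `π′⁻¹ O` with GIVEN node data `D′_j` principal off residual sets `R_j`, and the old atlas `𝔄`: an atlas `𝔄′` with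
  `F_𝔄′ ⊆ π′⁻¹(F_𝔄 ∖ O) ∪ ⋃_j (O′_j ∩ R_j)` (the caller keeps ITS pinned producer structures `E_j`, so the residual sets and the next centre are
  expressed through the same `E_j` — the X-scheme's P-states carry them existentially);
* `principalNear_producerChart_of_mem_colon` — chart-ring form: `aug σ′ ≤ (g′)`, `z ∈ 𝒜′0` with `z·g′ ∈ aug σ′`, `u′ ∈ D(E⁻¹ z)` ⇒ `PrincipalNear u′`;
* ★ `principalNear_producerChart_of_mem_residual` — (H1) form: `aug σ_R ≤ (g)` in `R^w`, a degree-0 chart element `z` in the extended RESIDUAL ideal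
  `𝔞·R_y`, `u′ ∈ D(E⁻¹ z)` ⇒ `PrincipalNear u′` — «off `V(𝔞)` the producer chart is principal» (`augmentationIdeal_sigmaChart_eq_span_mul_map_colon`).
-/

set_option linter.dupNamespace false

noncomputable section

open CategoryTheory Limits AlgebraicGeometry TopologicalSpace Topology
open Literature.AlgebraicGeometry.Resolution Literature.AlgebraicGeometry.RelativeSpec
open Summit.ResolutionOfSingularities.ResolutionOfSingularities.Theorems.WildQuotientResolution.S1
open Summit.ResolutionOfSingularities.ResolutionOfSingularities.Theorems.WildQuotientResolution.S1.NodeAtlas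
open Summit.ResolutionOfSingularities.ResolutionOfSingularities.Theorems.WildQuotientResolution.S1.CoarseChart
open Summit.ResolutionOfSingularities.ResolutionOfSingularities.Theorems.WildQuotientResolution.S1.ProducerStep
open Summit.ResolutionOfSingularities.ResolutionOfSingularities.Theorems.WildQuotientResolution.S1.NpFrame
open Summit.ResolutionOfSingularities.ResolutionOfSingularities.Theorems.WildQuotientResolution.S1.GoodCharts
open Summit.ResolutionOfSingularities.ResolutionOfSingularities.Theorems.WildQuotientResolution.S1.NodeChartAway
open Summit.ResolutionOfSingularities.ResolutionOfSingularities.Theorems.WildQuotientResolution.S1.KillableTransport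
open Summit.ResolutionOfSingularities.ResolutionOfSingularities.Theorems.WildQuotientResolution.S1.BlowupCharts
open Summit.ResolutionOfSingularities.ResolutionOfSingularities.Theorems.WildQuotientResolution.BlowupExit

namespace Summit.ResolutionOfSingularities.ResolutionOfSingularities.Theorems.WildQuotientResolution.S1

/-! ## Choice-free atlas assembly -/

namespace GameFrame.GModel

variable {p : ℕ} {X' X₁ : Scheme.{0}} {q : X' ⟶ X₁} {G : Type} [Group G] {ρ : G →* Aut X'} {g₀ : G}

/-- ★ **ATLAS ASSEMBLY FROM GIVEN PRODUCER NODE DATA.** A move `π′ : M′ → M` (blow-up of the `G`-stable `𝒦_d`, equivariant), an open `O ⊇ supp 𝒦_d`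
of `M`, stable affine opens `O′_j` of `M′` COVERING `π′⁻¹ O` with node data `D′_j` that are principal near every point of `O′_j` outside `R_j`, and
an atlas `𝔄` on `M`: there is an atlas `𝔄′` on `M′` (the `(O′_j, D′_j)` ∪ the transfers of the restrictions of the charts of `𝔄` to invariant basic
opens off the support) with `F_𝔄′ ⊆ π′⁻¹(F_𝔄 ∖ O) ∪ ⋃_j (O′_j ∩ R_j)`. [OURS · L1 W4.5c · R-F15b (1)/(3)/(6)] -/
theorem exists_moveAtlas_of_nodeData [Finite G] (M M' : GModel p q G ρ g₀) (𝔄 : NodeAtlasData p M.act g₀)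
    (𝒦 : ReesFiltration M.V) (d : ℕ) (h𝒦G : ∀ g : G, (𝒦.ideal d).comap (M.act.aut g).hom = 𝒦.ideal d)
    (π' : M'.V ⟶ M.V) (hbl : IsBlowup π' (𝒦.ideal d)) (hr : M'.r = π' ≫ M.r)
    (hcomm : ∀ g : G, (M'.act.aut g).hom ≫ π' = π' ≫ (M.act.aut g).hom)
    (O : Set M.V) (hsuppO : ((𝒦.ideal d).support : Set M.V) ⊆ O)
    {κ : Type} (O' : κ → M'.act.StableAffineOpens) (D' : ∀ j, NodeData p M'.act g₀ (O' j))
    (hcov : ∀ v' : M'.V, π'.base v' ∈ O → ∃ j, v' ∈ (O' j).1)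
    (R : κ → Set M'.V) (hD' : ∀ j, ∀ v' ∈ (O' j).1, v' ∉ R j → (D' j).PrincipalNear v') :
    ∃ 𝔄' : NodeAtlasData p M'.act g₀,
      𝔄'.fLocus ⊆ π'.base ⁻¹' (𝔄.fLocus \ O) ∪ ⋃ j, ((O' j).1 : Set M'.V) ∩ R j := by
  classical
  haveI := M.isIntegral
  -- the old charts, restricted to invariant basic opens off the support and transferred
  let J : Type := Σ i : 𝔄.ι, {b : Γ(M.V, (𝔄.O i).1) // (∀ g : G, actO M.act (𝔄.O i) g b = b) ∧
      Disjoint ((M.V.basicOpen b : Set M.V)) (((𝒦.ideal d).support : Set M.V))}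
  have hiso : ∀ jj : J, IsIso (π' ∣_ (basicOpenStable M.act (𝔄.O jj.1) (𝔄.D jj.1).affine jj.2.2.1).1) := fun jj =>
    hbl.isIso_morphismRestrict jj.2.2.2
  let OJ : J → M'.act.StableAffineOpens := fun jj =>
    haveI := hiso jj; NodeData.preimageStable M.act M'.act π' hr hcomm (basicOpenStable M.act (𝔄.O jj.1) (𝔄.D jj.1).affine jj.2.2.1)
  let DJ : ∀ jj : J, NodeData p M'.act g₀ (OJ jj) := fun jj =>
    haveI := hiso jj; ((𝔄.D jj.1).restrict jj.2.2.1).transfer M.act M'.act π' hr hcomm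
  have hJ : ∀ (jj : J) (v' : M'.V), (DJ jj).PrincipalNear v' ↔ π'.base v' ∈ M.V.basicOpen jj.2.1 ∧ (𝔄.D jj.1).PrincipalNear (π'.base v') := by
    intro jj v'
    haveI := hiso jj
    have h1 := NodeData.principalNear_transfer_iff M.act M'.act π' hr hcomm ((𝔄.D jj.1).restrict jj.2.2.1) v'
    constructor
    · intro h
      have h2 := h1.mp h
      have hub : π'.base v' ∈ M.V.basicOpen jj.2.1 := ((𝔄.D jj.1).restrict jj.2.2.1).mem_of_principalNear h2
      exact ⟨hub, ((𝔄.D jj.1).principalNear_restrict_iff jj.2.2.1 hub).mp h2⟩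
    · rintro ⟨hub, h⟩
      exact h1.mpr (((𝔄.D jj.1).principalNear_restrict_iff jj.2.2.1 hub).mpr h)
  have hoffb : ∀ u : M.V, u ∉ O → ∀ i, u ∈ (𝔄.O i).1 →
      ∃ b : Γ(M.V, (𝔄.O i).1), (∀ g : G, actO M.act (𝔄.O i) g b = b) ∧ u ∈ M.V.basicOpen b ∧
        Disjoint ((M.V.basicOpen b : Set M.V)) (((𝒦.ideal d).support : Set M.V)) := by
    intro u hu i hi
    have hsupp : u ∈ ((((𝒦.ideal d).support.compl : M.V.Opens)) : Set M.V) := fun h => hu (hsuppO h)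
    obtain ⟨b, hb, hub, hle⟩ := GoodCharts.exists_invariant_basicOpen M.act (𝔄.O i) (𝔄.D i).affine hi (𝒦.ideal d).support.compl
      (preimage_support_compl_of_comap_eq M h𝒦G) hsupp
    exact ⟨b, hb, hub, Set.disjoint_left.mpr fun x hx hx' => (hle hx) hx'⟩
  let 𝔄' : NodeAtlasData p M'.act g₀ :=
    { ι := J ⊕ κ
      O := Sum.elim OJ O'
      D := fun x => match x with
        | Sum.inl jj => DJ jj
        | Sum.inr j => D' j
      cover := fun v' => by
        by_cases hv : π'.base v' ∈ O
        · obtain ⟨j, hj⟩ := hcov v' hv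
          exact ⟨Sum.inr j, hj⟩
        · obtain ⟨i, hi⟩ := 𝔄.cover (π'.base v')
          obtain ⟨b, hb, hub, hdisj⟩ := hoffb _ hv i hi
          exact ⟨Sum.inl ⟨i, b, hb, hdisj⟩, hub⟩ }
  refine ⟨𝔄', fun v' hv' => ?_⟩
  by_cases hv : π'.base v' ∈ O
  · obtain ⟨j, hj⟩ := hcov v' hv
    refine Or.inr (Set.mem_iUnion.mpr ⟨j, hj, ?_⟩)
    by_contra hRj
    exact (NodeAtlasData.mem_fLocus_iff v').mp hv' (Sum.inr j) hj (hD' j v' hj hRj)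
  · refine Or.inl ⟨?_, hv⟩
    by_contra hF
    obtain ⟨i, hPi⟩ := (NodeAtlasData.not_mem_fLocus_iff (π'.base v')).mp hF
    obtain ⟨b, hb, hub, hdisj⟩ := hoffb _ hv i ((𝔄.D i).mem_of_principalNear hPi)
    exact (NodeAtlasData.mem_fLocus_iff v').mp hv' (Sum.inl ⟨i, b, hb, hdisj⟩) hub ((hJ ⟨i, b, hb, hdisj⟩ v').mpr ⟨hub, hPi⟩)

end GameFrame.GModel

/-! ## The residual-ideal certificate on a producer chart -/

namespace BlowupCharts

universe u

variable {p : ℕ} {V' V Y : Scheme.{u}} {π : V' ⟶ V} {q : V ⟶ Y} {G : Type u} [Group G] {ρ : ActionOver q G}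
  {r' : V' ⟶ Y} {ρ' : ActionOver r' G} {g₀ : G}

variable {m : ℕ} {r : Fin m → ℕ} {B : Type u} [CommRing B] {𝒜 : (Π j : Fin m, ZMod (r j)) → AddSubgroup B} [GradedRing 𝒜] {c : ℕ}
  {f : Fin c → B} {δ : Fin c → Π j : Fin m, ZMod (r j)} {w : Fin c → ℕ} {hf : ∀ i, f i ∈ 𝒜 (δ i)}
  {σ : B ≃+* B} {hσJ : ∀ n : ℕ, ((weightedFiltration f w).ideal n).map (σ : B →+* B) ≤ (weightedFiltration f w).ideal n}
  {hp : 0 < p} {hσp : ∀ x : B, (⇑σ)^[p] x = x} {dbar : ℕ} {y : ↥(𝒜 0)} {hy : y ∈ (traceFiltration 𝒜 f w).ideal dbar} {hσy : σ (y : B) = y}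

/-- **Chart-ring COLON certificate**: `aug σ′ ≤ (g′)`, a degree-0 chart element `z` with `z · g′ ∈ aug σ′`, and `u′ ∈ D(E⁻¹ z)` make the producer node
principal near `u′`. [OURS · L1 W4.5c · R-F15b (3) (PN-J) upstairs] -/
theorem principalNear_producerChart_of_mem_colon [Finite G] (hG : ∀ g : G, g ∈ Subgroup.zpowers g₀)
    (O' : ρ'.StableAffineOpens) (hO' : IsAffineOpen O'.1)
    (E : letI := chartNodeGradedRing r 𝒜 f w hf dbar y hy; Γ(V', O'.1) ≃+* ↥(chartNodeGrading r 𝒜 f w hf dbar y hy 0))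
    (htame' : letI := chartNodeGradedRing r 𝒜 f w hf dbar y hy;
      IsTameNode p (ChartRing 𝒜 f w dbar y hy) (chartNodeGrading r 𝒜 f w hf dbar y hy) (sigmaChart 𝒜 f w dbar y hy σ hσJ hp hσp hσy))
    (hE : letI := chartNodeGradedRing r 𝒜 f w hf dbar y hy; ∀ t' : Γ(V', O'.1),
      ((E ((ρ'.aut g₀⁻¹).hom.appLE O'.1 O'.1 (O'.2.1 g₀⁻¹).ge t') : ↥(chartNodeGrading r 𝒜 f w hf dbar y hy 0)) : ChartRing 𝒜 f w dbar y hy) =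
        sigmaChart 𝒜 f w dbar y hy σ hσJ hp hσp hσy ((E t' : ↥(chartNodeGrading r 𝒜 f w hf dbar y hy 0)) : ChartRing 𝒜 f w dbar y hy))
    (g' : ChartRing 𝒜 f w dbar y hy) (hFD1 : augmentationIdeal (sigmaChart 𝒜 f w dbar y hy σ hσJ hp hσp hσy) ≤ Ideal.span {g'})
    (z : letI := chartNodeGradedRing r 𝒜 f w hf dbar y hy; ↥(chartNodeGrading r 𝒜 f w hf dbar y hy 0))
    (hz : letI := chartNodeGradedRing r 𝒜 f w hf dbar y hy;
      (z : ChartRing 𝒜 f w dbar y hy) ∈ (augmentationIdeal (sigmaChart 𝒜 f w dbar y hy σ hσJ hp hσp hσy)).colon (Ideal.span {g'}))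
    {u' : V'} (huz : letI := chartNodeGradedRing r 𝒜 f w hf dbar y hy; u' ∈ V'.basicOpen (E.symm z)) :
    letI := chartNodeGradedRing r 𝒜 f w hf dbar y hy
    (({ affine := hO', m := m + 1, r := Fin.cons 0 r, B := ChartRing 𝒜 f w dbar y hy, 𝒜 := chartNodeGrading r 𝒜 f w hf dbar y hy,
        σ := sigmaChart 𝒜 f w dbar y hy σ hσJ hp hσp hσy, e := E, tame := htame', intertwine := hE } : NodeData p ρ' g₀ O')).PrincipalNear u' := by
  letI := chartNodeGradedRing r 𝒜 f w hf dbar y hy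
  refine principalNear_producerChart_of_certificate_upstairs hG O' hO' E htame' hE g' hFD1 z huz (k := 1) ?_
  rw [pow_one, mul_comm]
  exact Ideal.mem_colon_span_singleton.mp hz

/-- ★ **THE RESIDUAL-IDEAL CERTIFICATE** («off `V(𝔞)` the producer chart is principal»). Under (H1) `aug σ_R ≤ (g)` in the cobordant algebra `R^w`
(e.g. `g = β s` after a boundary-admissible move, `augmentationIdeal_sigmaR_le_span_of_admissible`), with `𝔞 := (aug σ_R : g)` the RESIDUAL ideal: a
degree-0 chart element `z` lying in the extended residual ideal `𝔞 · R_y` and a point `u′ ∈ D(E⁻¹ z)` give `PrincipalNear u′` for the producer node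
(on the chart `aug σ′ = (g)·𝔞R_y`, `augmentationIdeal_sigmaChart_eq_span_mul_map_colon`). [OURS · L1 W4.5c · R-F15b (3); A-KF v1 §2.2] -/
theorem principalNear_producerChart_of_mem_residual [Finite G] (hG : ∀ g : G, g ∈ Subgroup.zpowers g₀)
    (O' : ρ'.StableAffineOpens) (hO' : IsAffineOpen O'.1)
    (E : letI := chartNodeGradedRing r 𝒜 f w hf dbar y hy; Γ(V', O'.1) ≃+* ↥(chartNodeGrading r 𝒜 f w hf dbar y hy 0))
    (htame' : letI := chartNodeGradedRing r 𝒜 f w hf dbar y hy;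
      IsTameNode p (ChartRing 𝒜 f w dbar y hy) (chartNodeGrading r 𝒜 f w hf dbar y hy) (sigmaChart 𝒜 f w dbar y hy σ hσJ hp hσp hσy))
    (hE : letI := chartNodeGradedRing r 𝒜 f w hf dbar y hy; ∀ t' : Γ(V', O'.1),
      ((E ((ρ'.aut g₀⁻¹).hom.appLE O'.1 O'.1 (O'.2.1 g₀⁻¹).ge t') : ↥(chartNodeGrading r 𝒜 f w hf dbar y hy 0)) : ChartRing 𝒜 f w dbar y hy) =
        sigmaChart 𝒜 f w dbar y hy σ hσJ hp hσp hσy ((E t' : ↥(chartNodeGrading r 𝒜 f w hf dbar y hy 0)) : ChartRing 𝒜 f w dbar y hy))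
    {g : ↥(cobordantAlgebra f w)} (h1 : augmentationIdeal (sigmaR σ f w hσJ hp hσp) ≤ Ideal.span {g})
    (z : letI := chartNodeGradedRing r 𝒜 f w hf dbar y hy; ↥(chartNodeGrading r 𝒜 f w hf dbar y hy 0))
    (hz : letI := chartNodeGradedRing r 𝒜 f w hf dbar y hy;
      (z : ChartRing 𝒜 f w dbar y hy) ∈ ((augmentationIdeal (sigmaR σ f w hσJ hp hσp)).colon (Ideal.span {g})).map
        (algebraMap _ (ChartRing 𝒜 f w dbar y hy)))
    {u' : V'} (huz : letI := chartNodeGradedRing r 𝒜 f w hf dbar y hy; u' ∈ V'.basicOpen (E.symm z)) :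
    letI := chartNodeGradedRing r 𝒜 f w hf dbar y hy
    (({ affine := hO', m := m + 1, r := Fin.cons 0 r, B := ChartRing 𝒜 f w dbar y hy, 𝒜 := chartNodeGrading r 𝒜 f w hf dbar y hy,
        σ := sigmaChart 𝒜 f w dbar y hy σ hσJ hp hσp hσy, e := E, tame := htame', intertwine := hE } : NodeData p ρ' g₀ O')).PrincipalNear u' := by
  letI := chartNodeGradedRing r 𝒜 f w hf dbar y hy
  have haug := KillCert.augmentationIdeal_sigmaChart_eq_span_mul_map_colon f w σ hσJ hp hσp 𝒜 y hy hσy h1 (d := dbar)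
  refine principalNear_producerChart_of_certificate_upstairs hG O' hO' E htame' hE (algebraMap _ (ChartRing 𝒜 f w dbar y hy) g) ?_ z huz (k := 1) ?_
  · rw [haug]; exact Ideal.mul_le_right
  · rw [haug, pow_one]
    exact Ideal.mul_mem_mul (Ideal.mem_span_singleton_self _) hz

end BlowupCharts

end Summit.ResolutionOfSingularities.ResolutionOfSingularities.Theorems.WildQuotientResolution.S1

end
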